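import Mathlib
import HarnessLib

/-!
# Interpolatory rules on trigonometric abscissas: Fejér's first and second rules and the
# Clenshaw–Curtis rule — Davis–Rabinowitz (1984) Sect. 2.5.5

[cite: DavisRabinowitz1984, Sect. 2.5.5 (2.5.5.1)–(2.5.5.8) and the Clenshaw–Curtis display, pp. 84–86]

Davis & Rabinowitz, *Methods of Numerical Integration* (2nd ed., 1984), Sect. 2.5.5
"Integration rules of interpolatory type on the zeros (or extrema) of the Tschebyscheff
polynomials".  With `θ_k = (2k-1)π/(2n)` (the zeros `cos θ_k` of `T_n`) the interpolatory rule is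
obtained from the discrete cosine expansion of the interpolant (2.5.5.1)–(2.5.5.3) and the moments
`∫_{-1}^{1} T_m(x) dx = ∫_0^π cos mθ sin θ dθ = 2/(1 - m²)` (`m` even), `0` (`m` odd), giving
**Fejér's first rule** (2.5.5.5) `∫_{-1}^{1} f ≈ Σ_{k=1}^{n} w_k f(cos θ_k)`, exact for `f ∈ 𝒫_{n-1}`,
with the weights (2.5.5.4) `w_k = (2/n){1 - 2 Σ_{m=1}^{⌊n/2⌋} cos(2mθ_k)/(4m² - 1)}`.  "A similar
analysis with `U_n(cos θ) = sin(n+1)θ/sin θ`" yields **Fejér's second rule** (2.5.5.6) on the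
"Filippi" abscissas `cos(kπ/(n+1))`, `k = 1, …, n`, exact for `f ∈ 𝒫_{n-1}`, whose weights can be
written (2.5.5.8) `w_k = (4 sin θ_k/(n+1)) Σ_{m=1}^{⌊(n+1)/2⌋} sin(2m-1)θ_k/(2m-1)`, `θ_k = kπ/(n+1)`.
"In both (2.5.5.5) and (2.5.5.6), the weights `w_k` can be proved to be positive."  Adjoining the
end points `±1` gives the **Clenshaw–Curtis rule** on the "practical" abscissas
`x_k = cos((k-1)π/(n-1))`, `k = 1, …, n` (the extreme points of `T_{n-1}`), with
`w_1 = w_n = 1/(n-1)²` (`n` even), `1/(n(n-2))` (`n` odd) and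
`w_k = (2/(n-1)){1 - Σ*_{j=1}^{⌊(n-1)/2⌋} (2/(4j² - 1)) cos(2j(k-1)π/(n-1))}`, `k = 2, …, n-1`, where
`Σ*` means that the last term is halved if `n` is odd.

WHAT IS FORMALISED.  Everything is over `ℝ`, with Mathlib's `Polynomial.Chebyshev.T ℝ`.
* `integral_chebyshevT` — the moments `∫_{-1}^{1} T_m = (1 + (-1)^m)/(1 - m²)` (both parities in one
  formula; Lean's `x/0 = 0` makes it correct at `m = 1`), by the substitution `x = cos θ`.
* `nodeSum_exact_of_chebyshevT` — a node rule exact on `T_0, …, T_{m-1}` is exact on `𝒫_{m-1}`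
  (Chebyshev basis, Mathlib's `Polynomial.Sequence.span_degreeLT`).
* Fejér's first rule: `fejerOneAngle`/`fejerOneNode`/`fejerOneWeight` (2.5.5.4)/`fejerOne`;
  the node sums `sum_cos_fejerOneAngle_eq_zero` (via Mathlib's `sumZeroes` of `T_n`);
  `fejerOne_chebyshevT`, **`fejerOne_exact`** (2.5.5.5) for `P.degree < n`; **`fejerOneWeight_pos`**
  (indeed `w_k ≥ (2/n)/(2⌊n/2⌋ + 1)`), `sum_fejerOneWeight` (`= 2`).
* The Clenshaw–Curtis rule with `N = n - 1` panels, nodes `clenshawCurtisNode N k = cos(kπ/N)`, `k = 0, …, N`: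
  `clenshawCurtisWeight` (one formula with end-point multiplicities `clenshawCurtisMult` and the `Σ*` halving),
  `clenshawCurtis`; the folded full-period node sums `sum_cos_mul_pi_div_add`, `sum_clenshawCurtisMult_mul_cos`;
  `clenshawCurtis_chebyshevT` (exact on `T_i`, `i ≤ N`, the halved term absorbing the aliasing of
  `T_N` on its own extrema), **`clenshawCurtis_exact`** for `P.degree ≤ N` (`= n - 1`); the displayed
  end-point weights `clenshawCurtisWeight_zero_odd` (`1/N²`), `clenshawCurtisWeight_zero_even` (`1/(N² - 1)`),
  `clenshawCurtisWeight_last`, and `sum_clenshawCurtisWeight` (`= 2`).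
* Fejér's second rule: `fejerTwoAngle`/`fejerTwoNode`/`fejerTwoWeight` (2.5.5.8)/`fejerTwo`;
  node sums `sum_cos_fejerTwoAngle`; `fejerTwo_chebyshevT`, **`fejerTwo_exact`** (2.5.5.6) for
  `P.degree < n`; `sum_fejerTwoWeight` (`= 2`).
Not formalised: the intermediate form (2.5.5.7), positivity of the Fejér-2 and Clenshaw–Curtis
weights, the Basu rule, the convergence statements (Fejér, Gautschi) and the error constants `c_m`.
-/

namespace Literature.Analysis.Quadrature

open Real Finset Polynomial Polynomial.Chebyshev intervalIntegral

noncomputable section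

/-! ## `∫_{-1}^{1} T_m(x) dx` -/

/-- `∫_{-1}^{1} T_m(x) dx = ∫_0^π cos(mθ) sin θ dθ` (`x = cos θ`). [folklore] -/
private theorem integral_T_eq_integral_cos_mul_sin' (m : ℤ) :
    ∫ x in (-1 : ℝ)..1, (T ℝ m).eval x = ∫ θ in (0 : ℝ)..π, cos (m * θ) * sin θ := by
  have h := intervalIntegral.integral_comp_mul_deriv' (a := (0 : ℝ)) (b := π) (f := cos)
    (f' := fun θ => -sin θ) (g := fun x : ℝ => (T ℝ m).eval x)
    (fun θ _ => hasDerivAt_cos θ) (by fun_prop) (Polynomial.continuous _).continuousOn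
  rw [cos_zero, cos_pi, intervalIntegral.integral_symm (-1 : ℝ) 1] at h
  have h' : ∫ x in (-1 : ℝ)..1, (T ℝ m).eval x =
      -∫ θ in (0 : ℝ)..π, ((fun x : ℝ => (T ℝ m).eval x) ∘ cos) θ * -sin θ := by
    rw [h, neg_neg]
  rw [h', ← intervalIntegral.integral_neg]
  refine intervalIntegral.integral_congr fun θ _ => ?_
  simp only [Function.comp_apply, T_real_cos]
  ring

/-- **The moments of the Chebyshev polynomials on `[-1, 1]`** (the display preceding (2.5.5.4)):
`∫_{-1}^{1} T_m(x) dx = ∫_0^π cos(mθ) sin θ dθ = 2/(1 - m²)` for `m` even and `0` for `m` odd; uniformly,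
`= (1 + (-1)^m)/(1 - m²)` (at `m = 1` both sides vanish, the right one as `0/0 = 0`).
[cite: DavisRabinowitz1984, Sect. 2.5.5 (2.5.5.4)] -/
theorem integral_chebyshevT (m : ℕ) :
    ∫ x in (-1 : ℝ)..1, (T ℝ m).eval x = (1 + (-1) ^ m) / (1 - (m : ℝ) ^ 2) := by
  rcases Nat.lt_or_ge m 2 with hm | hm
  · interval_cases m
    · simp
    · have : (T ℝ ((1 : ℕ) : ℤ)) = X := by simp
      rw [this]; simp
  have hT := integral_T_eq_integral_cos_mul_sin' (m : ℤ)
  push_cast at hT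
  rw [hT]
  have hj1 : (1 : ℝ) < m := by exact_mod_cast hm
  have hjm : (0 : ℝ) < (m : ℝ) - 1 := by linarith
  have hjp : (0 : ℝ) < (m : ℝ) + 1 := by linarith
  -- antiderivative of `cos(mθ) sin θ = (sin((m+1)θ) - sin((m-1)θ))/2`
  set G : ℝ → ℝ := fun θ => cos ((m - 1) * θ) / (2 * (m - 1)) - cos ((m + 1) * θ) / (2 * (m + 1))
    with hG
  have hGd : ∀ θ : ℝ, HasDerivAt G (cos (m * θ) * sin θ) θ := by
    intro θ
    have h1 : HasDerivAt (fun θ : ℝ => cos ((m - 1) * θ)) (-sin ((m - 1) * θ) * ((m - 1) * 1)) θ :=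
      ((hasDerivAt_id' θ).const_mul ((m : ℝ) - 1)).cos
    have h2 : HasDerivAt (fun θ : ℝ => cos ((m + 1) * θ)) (-sin ((m + 1) * θ) * ((m + 1) * 1)) θ :=
      ((hasDerivAt_id' θ).const_mul ((m : ℝ) + 1)).cos
    have h := (h1.div_const (2 * ((m : ℝ) - 1))).sub (h2.div_const (2 * ((m : ℝ) + 1)))
    refine h.congr_deriv ?_
    rw [show ((m : ℝ) - 1) * θ = m * θ - θ by ring, show ((m : ℝ) + 1) * θ = m * θ + θ by ring,
      sin_sub, sin_add]
    field_simp
    ring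
  have hint : ∫ θ in (0 : ℝ)..π, cos (m * θ) * sin θ = G π - G 0 :=
    intervalIntegral.integral_eq_sub_of_hasDerivAt (fun θ _ => hGd θ)
      (by apply Continuous.intervalIntegrable; fun_prop)
  rw [hint]
  have hc1 : cos (((m : ℝ) - 1) * π) = -(-1) ^ m := by
    rw [show ((m : ℝ) - 1) * π = (m * π + π) - 2 * π by ring, cos_sub_two_pi, cos_add_pi,
      cos_nat_mul_pi]
  have hc2 : cos (((m : ℝ) + 1) * π) = -(-1) ^ m := by
    rw [show ((m : ℝ) + 1) * π = m * π + π by ring, cos_add_pi, cos_nat_mul_pi]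
  simp only [hG, mul_zero, cos_zero, hc1, hc2]
  have h1m : (1 : ℝ) - (m : ℝ) ^ 2 ≠ 0 := by nlinarith
  field_simp
  ring

/-! ## Node sums on the Chebyshev abscissas `cos((2k+1)π/(2n))` -/

/-- The angles of Fejér's first rule: `θ_k = (2k+1)π/(2n)`, `k = 0, …, n - 1` (the text's
`(2k-1)π/(2n)`, `k = 1, …, n`). [cite: DavisRabinowitz1984, Sect. 2.5.5 (2.5.5.2)] -/
def fejerOneAngle (n k : ℕ) : ℝ := (2 * k + 1) / (2 * n) * π

/-- The abscissas of Fejér's first rule: the zeros `x_k = cos θ_k` of `T_n`.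
[cite: DavisRabinowitz1984, Sect. 2.5.5 (2.5.5.2)] -/
def fejerOneNode (n k : ℕ) : ℝ := cos (fejerOneAngle n k)

/-- `Σ_{k<n} T_a(x_k) = (n/π) · sumZeroes n T_a` (Mathlib's Chebyshev–Gauss functional). [folklore] -/
private theorem sum_cos_fejerOneAngle_eq_sumZeroes {n : ℕ} (hn : n ≠ 0) (a : ℤ) :
    ∑ k ∈ range n, cos (a * fejerOneAngle n k) = n / π * sumZeroes n (T ℝ a) := by
  have hπ : (π : ℝ) ≠ 0 := pi_ne_zero
  have hnr : (n : ℝ) ≠ 0 := by exact_mod_cast hn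
  simp only [sumZeroes, fejerOneAngle, T_real_cos]
  field_simp
  refine sum_congr rfl fun k _ => ?_
  congr 1
  ring

/-- The node sums of Fejér's first rule: `Σ_{k<n} cos(a θ_k) = 0` whenever `2n ∤ a`. [folklore] -/
private theorem sum_cos_fejerOneAngle_eq_zero {n : ℕ} (hn : n ≠ 0) {a : ℤ} (ha : ¬ (2 * n : ℤ) ∣ a) :
    ∑ k ∈ range n, cos (a * fejerOneAngle n k) = 0 := by
  rw [sum_cos_fejerOneAngle_eq_sumZeroes hn, sumZeroes_T_of_not_dvd ha, mul_zero]

/-- `cos(aθ) cos(bθ) = (cos((a+b)θ) + cos((a-b)θ))/2`. [folklore] -/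
private theorem cos_mul_cos_eq (a b θ : ℝ) :
    cos (a * θ) * cos (b * θ) = (cos ((a + b) * θ) + cos ((a - b) * θ)) / 2 := by
  rw [add_mul, sub_mul, cos_add, cos_sub]; ring

/-- Discrete orthogonality on the zeros of `T_n`: for `1 ≤ m ≤ n/2` and `j < n`,
`Σ_{k<n} cos(2mθ_k) cos(jθ_k) = (n/2)·[2m = j]`. [folklore] -/
private theorem sum_cos_two_mul_cos {n m j : ℕ} (hm : m ∈ Icc 1 (n / 2)) (hj : j < n) :
    ∑ k ∈ range n, cos (2 * m * fejerOneAngle n k) * cos (j * fejerOneAngle n k)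
      = if 2 * m = j then (n : ℝ) / 2 else 0 := by
  have hn : n ≠ 0 := by omega
  obtain ⟨hm1, hm2⟩ := mem_Icc.mp hm
  have hmn : 2 * m ≤ n := by omega
  simp_rw [cos_mul_cos_eq]
  rw [← sum_div, sum_add_distrib]
  -- the frequency `2m + j` : `0 < 2m + j < 2n`
  have h1 : ∑ k ∈ range n, cos ((2 * m + j : ℝ) * fejerOneAngle n k) = 0 := by
    have := sum_cos_fejerOneAngle_eq_zero hn (a := ((2 * m + j : ℕ) : ℤ))
      (by
        intro hd
        have := Int.le_of_dvd (by push_cast; omega) hd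
        push_cast at this; omega)
    push_cast at this
    exact this
  rw [h1, zero_add]
  split_ifs with hmj
  · -- frequency `0`
    have : ∀ k ∈ range n, cos ((2 * m - j : ℝ) * fejerOneAngle n k) = 1 := by
      intro k _
      rw [show (2 * m - j : ℝ) = 0 by rw [← hmj]; push_cast; ring, zero_mul, cos_zero]
    rw [sum_congr rfl this, sum_const, card_range, nsmul_eq_mul, mul_one]
  · have := sum_cos_fejerOneAngle_eq_zero hn (a := ((2 * m : ℕ) : ℤ) - j)
      (by
        intro hd
        rcases eq_or_ne (((2 * m : ℕ) : ℤ) - j) 0 with h0 | h0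
        · apply hmj; push_cast at h0; omega
        · have := Int.natAbs_le_of_dvd_ne_zero hd h0
          push_cast at this; omega)
    push_cast at this
    rw [this, zero_div]

/-! ## Fejér's first rule (2.5.5.4)–(2.5.5.5) -/

/-- The weights of Fejér's first rule (2.5.5.4):
`w_k = (2/n){1 - 2 Σ_{m=1}^{⌊n/2⌋} cos(2mθ_k)/(4m² - 1)}`. [cite: DavisRabinowitz1984, Sect. 2.5.5 (2.5.5.4)] -/
def fejerOneWeight (n k : ℕ) : ℝ :=
  2 / n * (1 - 2 * ∑ m ∈ Icc 1 (n / 2), cos (2 * m * fejerOneAngle n k) / (4 * (m : ℝ) ^ 2 - 1))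

/-- Fejér's first integration formula (2.5.5.5): `Σ_{k} w_k f(cos θ_k)`.
[cite: DavisRabinowitz1984, Sect. 2.5.5 (2.5.5.5)] -/
def fejerOne (n : ℕ) (f : ℝ → ℝ) : ℝ := ∑ k ∈ range n, fejerOneWeight n k * f (fejerOneNode n k)

/-- Fejér's first rule on the Chebyshev polynomials `T_j`, `j < n`:
`Σ_k w_k T_j(x_k) = (1 + (-1)^j)/(1 - j²) = ∫_{-1}^{1} T_j`. [cite: DavisRabinowitz1984, Sect. 2.5.5 (2.5.5.5)] -/
theorem fejerOne_chebyshevT {n j : ℕ} (hj : j < n) :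
    fejerOne n (fun x => (T ℝ j).eval x) = (1 + (-1) ^ j) / (1 - (j : ℝ) ^ 2) := by
  have hn : n ≠ 0 := by omega
  have hnr : (n : ℝ) ≠ 0 := by exact_mod_cast hn
  unfold fejerOne
  have hT : ∀ k : ℕ, (T ℝ (j : ℤ)).eval (fejerOneNode n k) = cos (j * fejerOneAngle n k) := by
    intro k; rw [fejerOneNode, T_real_cos]; push_cast; ring_nf
  simp_rw [hT]
  -- per node: `w_k cos(jθ_k) = (2/n) cos(jθ_k) - (4/n) Σ_m c_m cos(2mθ_k) cos(jθ_k)`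
  have hsplit : ∀ k : ℕ, fejerOneWeight n k * cos (j * fejerOneAngle n k)
      = 2 / (n : ℝ) * cos (j * fejerOneAngle n k) - 4 / (n : ℝ) * ∑ m ∈ Icc 1 (n / 2),
          1 / (4 * (m : ℝ) ^ 2 - 1) * (cos (2 * m * fejerOneAngle n k) * cos (j * fejerOneAngle n k)) := by
    intro k
    have : ∑ m ∈ Icc 1 (n / 2), 1 / (4 * (m : ℝ) ^ 2 - 1)
          * (cos (2 * m * fejerOneAngle n k) * cos (j * fejerOneAngle n k))
        = (∑ m ∈ Icc 1 (n / 2), cos (2 * m * fejerOneAngle n k) / (4 * (m : ℝ) ^ 2 - 1))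
          * cos (j * fejerOneAngle n k) := by
      rw [sum_mul]; exact sum_congr rfl fun m _ => by ring
    rw [this, fejerOneWeight]; ring
  have hB : ∑ m ∈ Icc 1 (n / 2), 1 / (4 * (m : ℝ) ^ 2 - 1)
        * ∑ k ∈ range n, cos (2 * m * fejerOneAngle n k) * cos (j * fejerOneAngle n k)
      = ∑ m ∈ Icc 1 (n / 2), 1 / (4 * (m : ℝ) ^ 2 - 1) * (if 2 * m = j then (n : ℝ) / 2 else 0) :=
    sum_congr rfl fun m hm => by rw [sum_cos_two_mul_cos hm hj]
  have hLHS : ∑ k ∈ range n, fejerOneWeight n k * cos (j * fejerOneAngle n k)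
      = 2 / (n : ℝ) * ∑ k ∈ range n, cos (j * fejerOneAngle n k)
        - 4 / (n : ℝ) * ∑ m ∈ Icc 1 (n / 2), 1 / (4 * (m : ℝ) ^ 2 - 1)
            * (if 2 * m = j then (n : ℝ) / 2 else 0) := by
    rw [← hB, sum_congr rfl fun k _ => hsplit k, sum_sub_distrib, ← mul_sum, ← mul_sum, sum_comm]
    simp_rw [← mul_sum]
  rw [hLHS]
  rcases Nat.eq_zero_or_pos j with hj0 | hj0
  · -- `j = 0`: `Σ_k cos 0 = n`, and no `m ≥ 1` has `2m = 0`
    subst hj0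
    have h0 : ∑ k ∈ range n, cos (((0 : ℕ) : ℝ) * fejerOneAngle n k) = n := by simp
    have h0' : ∑ m ∈ Icc 1 (n / 2), 1 / (4 * (m : ℝ) ^ 2 - 1)
        * (if 2 * m = 0 then (n : ℝ) / 2 else 0) = 0 := by
      refine sum_eq_zero fun m hm => ?_
      rw [if_neg (by have := (mem_Icc.mp hm).1; omega), mul_zero]
    rw [h0, h0']
    field_simp
    ring
  · have h1 : ∑ k ∈ range n, cos ((j : ℝ) * fejerOneAngle n k) = 0 := by
      have := sum_cos_fejerOneAngle_eq_zero hn (a := (j : ℤ))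
        (by
          intro hd
          have := Int.le_of_dvd (by exact_mod_cast hj0) hd
          omega)
      exact_mod_cast this
    rw [h1, mul_zero, zero_sub]
    rcases Nat.even_or_odd j with ⟨i, hi⟩ | hodd
    · -- `j = 2i` with `1 ≤ i ≤ n/2`: the single term `m = i`
      have hi' : j = 2 * i := by omega
      have hiI : i ∈ Icc 1 (n / 2) := mem_Icc.mpr ⟨by omega, by omega⟩
      rw [sum_eq_single_of_mem i hiI (fun m _ hmi => by rw [if_neg (by omega), mul_zero]),
        if_pos (by omega)]
      have hjr : (j : ℝ) = 2 * i := by rw [hi']; push_cast; ring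
      have hev : ((-1 : ℝ)) ^ j = 1 := by rw [hi']; exact (even_two_mul i).neg_one_pow
      rw [hjr, hev]
      have hi1 : (1 : ℝ) ≤ i := by exact_mod_cast (show 1 ≤ i by omega)
      have hden : (4 : ℝ) * (i : ℝ) ^ 2 - 1 ≠ 0 := by nlinarith
      have hden' : (1 : ℝ) - (2 * (i : ℝ)) ^ 2 ≠ 0 := by nlinarith
      rw [eq_div_iff hden']
      field_simp
      ring
    · -- `j` odd: no term, and `∫ T_j = 0`
      have h2 : ∑ m ∈ Icc 1 (n / 2), 1 / (4 * (m : ℝ) ^ 2 - 1)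
          * (if 2 * m = j then (n : ℝ) / 2 else 0) = 0 := by
        refine sum_eq_zero fun m _ => ?_
        rw [if_neg (by intro h; apply Nat.not_even_iff_odd.mpr hodd; exact ⟨m, by omega⟩), mul_zero]
      rw [h2, mul_zero, neg_zero, hodd.neg_one_pow]
      ring

/-- A node functional `f ↦ Σ_{k ∈ s} w_k f(x_k)` which integrates `T_0, …, T_{m-1}` exactly over
`[-1, 1]` integrates every polynomial of degree `< m` exactly (expand in the Chebyshev basis,
Mathlib's `Polynomial.Sequence.span_degreeLT`). [folklore] -/
private theorem nodeSum_exact_of_chebyshevT {ι : Type*} (s : Finset ι) (w x : ι → ℝ) {m : ℕ}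
    (hT : ∀ i : ℕ, i < m →
      ∑ k ∈ s, w k * (T ℝ i).eval (x k) = ∫ t in (-1 : ℝ)..1, (T ℝ i).eval t)
    {P : ℝ[X]} (hP : P.degree < m) :
    ∑ k ∈ s, w k * P.eval (x k) = ∫ t in (-1 : ℝ)..1, P.eval t := by
  -- expand `P` in the Chebyshev basis `T_0, …, T_{m-1}`
  have hmem : P ∈ degreeLT ℝ m := by rwa [mem_degreeLT]
  rw [← Sequence.span_degreeLT (chebyshevTsequence ℝ) (by simp),
    show Set.Iio m = Finset.range m by simp,
    Submodule.mem_span_image_finset_iff_exists_fun'] at hmem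
  obtain ⟨c, rfl⟩ := hmem
  -- both sides are linear
  have hR : ∫ t in (-1 : ℝ)..1, (∑ i ∈ range m, c i • (chebyshevTsequence ℝ i : ℝ[X])).eval t
      = ∑ i ∈ range m, c i * ∫ t in (-1 : ℝ)..1, (T ℝ i).eval t := by
    simp_rw [eval_finsetSum, eval_smul, smul_eq_mul]
    rw [intervalIntegral.integral_finsetSum]
    · refine sum_congr rfl fun i _ => ?_
      rw [intervalIntegral.integral_const_mul]
      simp [chebyshevTsequence]
    · intro i _
      exact (Continuous.intervalIntegrable (by fun_prop) _ _)
  rw [hR]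
  simp_rw [eval_finsetSum, eval_smul, smul_eq_mul, mul_sum]
  rw [sum_comm]
  refine sum_congr rfl fun i hi => ?_
  rw [← hT i (mem_range.mp hi), mul_sum]
  refine sum_congr rfl fun k _ => ?_
  simp [chebyshevTsequence]
  ring

/-- **Fejér's first rule (2.5.5.5) is exact on `𝒫_{n-1}`**: for every real polynomial `P` of degree
`≤ n - 1`, `Σ_{k} w_k P(cos θ_k) = ∫_{-1}^{1} P(x) dx`, with the weights (2.5.5.4).
[cite: DavisRabinowitz1984, Sect. 2.5.5 (2.5.5.5)] -/
theorem fejerOne_exact {n : ℕ} {P : ℝ[X]} (hP : P.degree < n) :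
    fejerOne n (fun x => P.eval x) = ∫ x in (-1 : ℝ)..1, P.eval x :=
  nodeSum_exact_of_chebyshevT (range n) (fejerOneWeight n) (fejerOneNode n)
    (fun i hi => by rw [integral_chebyshevT i]; exact fejerOne_chebyshevT hi) hP

/-- `Σ_{m=1}^{M} 1/(4m² - 1) = M/(2M + 1)` (telescoping). [folklore] -/
private theorem sum_inv_four_sq_sub_one (M : ℕ) :
    ∑ m ∈ Icc 1 M, 1 / (4 * (m : ℝ) ^ 2 - 1) = (M : ℝ) / (2 * (M : ℝ) + 1) := by
  induction M with
  | zero => simp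
  | succ M ih =>
    have hM : (0 : ℝ) ≤ M := by positivity
    have hA : (2 : ℝ) * (M : ℝ) + 1 ≠ 0 := by positivity
    have hB : (4 : ℝ) * (((M + 1 : ℕ) : ℝ)) ^ 2 - 1 ≠ 0 := by push_cast; nlinarith
    have hC : (2 : ℝ) * ((M + 1 : ℕ) : ℝ) + 1 ≠ 0 := by positivity
    rw [sum_Icc_succ_top (by omega), ih, div_add_div _ _ hA hB, div_eq_div_iff (mul_ne_zero hA hB) hC]
    push_cast
    ring

/-- **The weights of Fejér's first rule are positive** ("the weights `w_k` can be proved to be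
positive", p. 85): indeed `w_k ≥ (2/n)/(2⌊n/2⌋ + 1) > 0`, bounding each cosine by `1` and
telescoping `Σ_{m=1}^{M} 1/(4m² - 1) = M/(2M + 1)`. [cite: DavisRabinowitz1984, Sect. 2.5.5 (2.5.5.4)] -/
theorem fejerOneWeight_pos {n : ℕ} (hn : n ≠ 0) (k : ℕ) : 0 < fejerOneWeight n k := by
  have hnr : (0 : ℝ) < n := by exact_mod_cast Nat.pos_of_ne_zero hn
  unfold fejerOneWeight
  have hle : ∑ m ∈ Icc 1 (n / 2), cos (2 * m * fejerOneAngle n k) / (4 * (m : ℝ) ^ 2 - 1)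
      ≤ ∑ m ∈ Icc 1 (n / 2), 1 / (4 * (m : ℝ) ^ 2 - 1) := by
    refine sum_le_sum fun m hm => ?_
    have hm1 : (1 : ℝ) ≤ m := by exact_mod_cast (mem_Icc.mp hm).1
    have hpos : (0 : ℝ) < 4 * (m : ℝ) ^ 2 - 1 := by nlinarith
    exact div_le_div_of_nonneg_right (cos_le_one _) hpos.le
  rw [sum_inv_four_sq_sub_one] at hle
  have hM : (0 : ℝ) ≤ (n / 2 : ℕ) := by positivity
  have : (0 : ℝ) < 1 - 2 * ∑ m ∈ Icc 1 (n / 2),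
      cos (2 * m * fejerOneAngle n k) / (4 * (m : ℝ) ^ 2 - 1) := by
    have : 1 - 2 * ((n / 2 : ℕ) / (2 * (n / 2 : ℕ) + 1) : ℝ) = 1 / (2 * (n / 2 : ℕ) + 1) := by
      field_simp; ring
    have hp : (0 : ℝ) < 1 / (2 * (n / 2 : ℕ) + 1) := by positivity
    linarith
  exact mul_pos (by positivity) this

/-- The weights of Fejér's first rule sum to `2 = ∫_{-1}^{1} dx`. [cite: DavisRabinowitz1984, Sect. 2.5.5 (2.5.5.5)] -/
theorem sum_fejerOneWeight {n : ℕ} (hn : n ≠ 0) : ∑ k ∈ range n, fejerOneWeight n k = 2 := by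
  have h := fejerOne_chebyshevT (n := n) (j := 0) (Nat.pos_of_ne_zero hn)
  unfold fejerOne at h
  have h' : ∑ k ∈ range n, fejerOneWeight n k
      = ∑ k ∈ range n, fejerOneWeight n k * (fun x => (T ℝ ((0 : ℕ) : ℤ)).eval x) (fejerOneNode n k) := by
    refine sum_congr rfl fun k _ => ?_
    simp
  rw [h', h]
  norm_num

/-! ## Node sums on the "practical" abscissas `cos(kπ/N)` (trapezoidal sums of cosines) -/

/-- Full-period cosine sums: `Σ_{k<M} cos(2π a k/M) = M` if `M ∣ a`, else `0`. [folklore] -/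
private theorem sum_cos_two_pi_mul_div {M : ℕ} (hM : M ≠ 0) (a : ℤ) :
    ∑ k ∈ range M, cos (2 * π * a * k / M) = if (M : ℤ) ∣ a then (M : ℝ) else 0 := by
  -- real part of the roots-of-unity sum
  have hMc : (M : ℂ) ≠ 0 := by exact_mod_cast hM
  set ζ := Complex.exp (2 * π * Complex.I / M) with hζ
  have hprim : IsPrimitiveRoot ζ M := Complex.isPrimitiveRoot_exp M hM
  have hpow : ∀ k : ℕ, Complex.exp (2 * π * a * k / M * Complex.I) = (ζ ^ a) ^ k := by
    intro k
    rw [hζ, ← Complex.exp_int_mul, ← Complex.exp_nat_mul]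
    congr 1
    field_simp
  have hre : ∀ k : ℕ, cos (2 * π * a * k / M) = (Complex.exp (2 * π * a * k / M * Complex.I)).re := by
    intro k
    rw [← Complex.exp_ofReal_mul_I_re]
    push_cast
    ring_nf
  simp_rw [hre, ← Complex.re_sum, hpow]
  split_ifs with hdvd
  · have h1 : ζ ^ a = 1 := by
      obtain ⟨m, hm⟩ := hdvd
      rw [hm, zpow_mul, zpow_natCast, hprim.pow_eq_one, one_zpow]
    simp [h1]
  · have h1 : ζ ^ a ≠ 1 := fun h => hdvd ((hprim.zpow_eq_one_iff_dvd a).mp h)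
    rw [geom_sum_eq h1, ← zpow_natCast, ← zpow_mul, mul_comm, zpow_mul, zpow_natCast,
      hprim.pow_eq_one, one_zpow, sub_self, zero_div, Complex.zero_re]

/-- The trapezoidal cosine sums on `[0, π]` with `N` panels:
`Σ_{k=0}^{N-1} cos(akπ/N) + Σ_{k=1}^{N} cos(akπ/N) = 2N` if `2N ∣ a`, else `0`
(the sum over the full period `Σ_{k<2N} cos(akπ/N)` folded by `k ↦ 2N - k`). [folklore] -/
private theorem sum_cos_mul_pi_div_add {N : ℕ} (hN : N ≠ 0) (a : ℤ) :
    ∑ k ∈ range N, cos (a * k * π / N) + ∑ k ∈ range N, cos (a * (k + 1 : ℕ) * π / N)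
      = if (2 * N : ℤ) ∣ a then 2 * (N : ℝ) else 0 := by
  have hNr : (N : ℝ) ≠ 0 := by exact_mod_cast hN
  have hfull := sum_cos_two_pi_mul_div (M := 2 * N) (by omega) a
  push_cast at hfull
  rw [show (2 * N : ℕ) = N + N by ring, sum_range_add] at hfull
  -- second half: reflect `k ↦ N - 1 - k`
  have hrefl : ∑ k ∈ range N, cos (2 * π * a * ((N + k : ℕ) : ℝ) / (2 * N))
      = ∑ k ∈ range N, cos (a * (k + 1 : ℕ) * π / N) := by
    rw [← sum_range_reflect (fun k => cos (a * (k + 1 : ℕ) * π / N)) N]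
    refine sum_congr rfl fun k hk => ?_
    have hk' : k < N := mem_range.mp hk
    have : (a : ℝ) * ((N - 1 - k + 1 : ℕ) : ℝ) * π / N = 2 * π * a - 2 * π * a * ((N + k : ℕ) : ℝ) / (2 * N) + 2 * π * a * 0 := by
      rw [show (N - 1 - k + 1 : ℕ) = N - k from by omega]
      rw [Nat.cast_sub hk'.le]
      push_cast
      field_simp
      ring
    rw [this, mul_zero, add_zero, show (2 : ℝ) * π * a = (a : ℤ) * (2 * π) by ring,
      cos_int_mul_two_pi_sub]
  have hfirst : ∑ k ∈ range N, cos (2 * π * a * (k : ℝ) / (2 * N)) = ∑ k ∈ range N, cos (a * k * π / N) := by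
    refine sum_congr rfl fun k _ => ?_
    congr 1; field_simp
  have hfull' : ∑ k ∈ range N, cos (2 * π * a * (k : ℝ) / (2 * N))
      + ∑ k ∈ range N, cos (2 * π * a * ((N + k : ℕ) : ℝ) / (2 * N))
      = if (2 * N : ℤ) ∣ a then 2 * (N : ℝ) else 0 := by
    convert hfull using 2
  rw [← hfirst, ← hrefl, hfull']

/-! ## The Clenshaw–Curtis rule on the "practical" abscissas `cos(kπ/N)` -/

/-- The Clenshaw–Curtis ("practical") abscissas `x_k = cos(kπ/N)`, `k = 0, …, N` — the extreme
points of `T_N` (the text's `cos((k-1)π/(n-1))`, `k = 1, …, n`, with `n = N + 1` points).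
[cite: DavisRabinowitz1984, Sect. 2.5.5 (2.5.5.8)] -/
def clenshawCurtisNode (N k : ℕ) : ℝ := cos (k * π / N)

/-- End-point multiplicity of the Clenshaw–Curtis weights: `1` at `k = 0, N`, `2` inside. [cite: DavisRabinowitz1984, Sect. 2.5.5 (2.5.5.8)] -/
def clenshawCurtisMult (N k : ℕ) : ℝ := if k = 0 ∨ k = N then 1 else 2

/-- The Clenshaw–Curtis weights (the display following (2.5.5.8), p. 86), written uniformly for
end points and interior points:
`w_k = (c_k/N){1 - Σ*_{j=1}^{⌊N/2⌋} (2/(4j² - 1)) cos(2jkπ/N)}`, `c_0 = c_N = 1`, `c_k = 2` otherwise,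
where `Σ*` halves the last term when `N` is even (`2j = N`; the text: "halved if `n` is odd",
`n = N + 1`).  At the end points this evaluates to `1/N²` (`N` odd) and `1/(N² - 1)` (`N` even),
the text's `w_1 = w_n` (`clenshawCurtisWeight_zero_odd`, `clenshawCurtisWeight_zero_even`).
[cite: DavisRabinowitz1984, Sect. 2.5.5 (2.5.5.8)] -/
def clenshawCurtisWeight (N k : ℕ) : ℝ :=
  clenshawCurtisMult N k / N * (1 - ∑ j ∈ Icc 1 (N / 2),
    (if 2 * j = N then (1 : ℝ) else 2) / (4 * (j : ℝ) ^ 2 - 1) * cos (2 * j * k * π / N))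

/-- The `(N+1)`-point Clenshaw–Curtis rule `Σ_{k=0}^{N} w_k f(cos(kπ/N))`.
[cite: DavisRabinowitz1984, Sect. 2.5.5 (2.5.5.8)] -/
def clenshawCurtis (N : ℕ) (f : ℝ → ℝ) : ℝ := ∑ k ∈ range (N + 1), clenshawCurtisWeight N k * f (clenshawCurtisNode N k)

/-- Sums with the end-point multiplicities are sums over two shifted ranges:
`Σ_{k=0}^{N} c_k g(k) = Σ_{k=0}^{N-1} g(k) + Σ_{k=1}^{N} g(k)`. [folklore] -/
private theorem sum_clenshawCurtisMult_mul {N : ℕ} (hN : N ≠ 0) (g : ℕ → ℝ) :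
    ∑ k ∈ range (N + 1), clenshawCurtisMult N k * g k = ∑ k ∈ range N, g k + ∑ k ∈ range N, g (k + 1) := by
  have hsplit : ∀ k ∈ range (N + 1), clenshawCurtisMult N k * g k
      = (if k = N then 0 else g k) + (if k = 0 then 0 else g k) := by
    intro k hk
    unfold clenshawCurtisMult
    have hkN : k ≤ N := Nat.lt_succ_iff.mp (mem_range.mp hk)
    by_cases h0 : k = 0
    · subst h0; simp [Ne.symm hN]
    · by_cases hN' : k = N
      · subst hN'; simp [h0]
      · simp [h0, hN']; ring
  rw [sum_congr rfl hsplit, sum_add_distrib, sum_range_succ, sum_range_succ' (fun k => if k = 0 then 0 else g k)]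
  simp only [if_true, add_zero, Nat.succ_ne_zero, if_false]
  congr 1
  exact sum_congr rfl fun k hk => if_neg (by have := mem_range.mp hk; omega)

/-- The trapezoidal node sums of the Clenshaw–Curtis rule:
`Σ_{k=0}^{N} c_k cos(akπ/N) = 2N` if `2N ∣ a`, else `0`. [folklore] -/
private theorem sum_clenshawCurtisMult_mul_cos {N : ℕ} (hN : N ≠ 0) (a : ℤ) :
    ∑ k ∈ range (N + 1), clenshawCurtisMult N k * cos (a * k * π / N)
      = if (2 * N : ℤ) ∣ a then 2 * (N : ℝ) else 0 := by
  rw [sum_clenshawCurtisMult_mul hN (fun k => cos (a * k * π / N)), ← sum_cos_mul_pi_div_add hN a]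

/-- Discrete orthogonality on the practical abscissas: for `1 ≤ j ≤ N/2` and `i ≤ N`,
`Σ_k c_k cos(2jkπ/N) cos(ikπ/N) = N([2j + i = 2N] + [2j = i])`. [folklore] -/
private theorem sum_clenshawCurtisMult_cos_cos {N j i : ℕ} (hj : j ∈ Icc 1 (N / 2)) (hi : i ≤ N) :
    ∑ k ∈ range (N + 1), clenshawCurtisMult N k * (cos (2 * j * k * π / N) * cos (i * k * π / N))
      = (N : ℝ) * ((if 2 * j + i = 2 * N then 1 else 0) + (if 2 * j = i then 1 else 0)) := by
  obtain ⟨hj1, hj2⟩ := mem_Icc.mp hj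
  have hjN : 2 * j ≤ N := by omega
  have hN : N ≠ 0 := by omega
  have hcc : ∀ k : ℕ, cos (2 * j * k * π / N) * cos (i * k * π / N)
      = (cos (((2 * j + i : ℕ) : ℤ) * k * π / N) + cos ((((2 * j : ℕ) : ℤ) - i : ℤ) * k * π / N)) / 2 := by
    intro k
    have := cos_mul_cos_eq (2 * j) i (k * π / N)
    push_cast at this ⊢
    rw [show (2 : ℝ) * j * k * π / N = 2 * j * (k * π / N) by ring,
      show (i : ℝ) * k * π / N = i * (k * π / N) by ring, this]
    congr 2 <;> ring
  simp_rw [hcc, mul_div_assoc', ← sum_div, mul_add, sum_add_distrib, sum_clenshawCurtisMult_mul_cos hN]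
  -- first indicator: `2N ∣ 2j + i ↔ 2j + i = 2N` (as `2 ≤ 2j + i ≤ 2N`)
  have e1 : ((2 * N : ℤ) ∣ ((2 * j + i : ℕ) : ℤ)) ↔ 2 * j + i = 2 * N := by
    constructor
    · intro hd
      obtain ⟨c, hc⟩ := hd
      have hc1 : (0 : ℤ) < c := by
        by_contra hle; rw [not_lt] at hle
        have : ((2 * j + i : ℕ) : ℤ) ≤ 0 := by rw [hc]; nlinarith
        push_cast at this; omega
      have hc2 : c < 2 := by
        by_contra hle; rw [not_lt] at hle
        have : (2 * N : ℤ) * 2 ≤ ((2 * j + i : ℕ) : ℤ) := by rw [hc]; nlinarith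
        push_cast at this; omega
      have hc' : c = 1 := by omega
      subst hc'; push_cast at hc; omega
    · intro h; rw [h]; push_cast; exact dvd_rfl
  -- second indicator: `2N ∣ 2j - i ↔ 2j = i` (as `|2j - i| < 2N`)
  have e2 : ((2 * N : ℤ) ∣ (((2 * j : ℕ) : ℤ) - i)) ↔ 2 * j = i := by
    constructor
    · intro hd
      rcases eq_or_ne ((((2 * j : ℕ) : ℤ) - i)) 0 with h0 | h0
      · push_cast at h0; omega
      · have := Int.natAbs_le_of_dvd_ne_zero hd h0
        push_cast at this; omega
    · intro h; rw [show (((2 * j : ℕ) : ℤ) - i) = 0 by push_cast; omega]; exact dvd_zero _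
  simp only [e1, e2]
  split_ifs <;> ring

/-- The Clenshaw–Curtis rule on the Chebyshev polynomials `T_i`, `i ≤ N`:
`Σ_k w_k T_i(x_k) = (1 + (-1)^i)/(1 - i²) = ∫_{-1}^{1} T_i` — including `i = N`, where the halved last
term of `Σ*` accounts for the aliasing of `T_N` on its own extreme points.
[cite: DavisRabinowitz1984, Sect. 2.5.5 (2.5.5.8)] -/
theorem clenshawCurtis_chebyshevT {N i : ℕ} (hN : N ≠ 0) (hi : i ≤ N) :
    clenshawCurtis N (fun x => (T ℝ i).eval x) = (1 + (-1) ^ i) / (1 - (i : ℝ) ^ 2) := by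
  have hNr : (N : ℝ) ≠ 0 := by exact_mod_cast hN
  unfold clenshawCurtis
  have hT : ∀ k : ℕ, (T ℝ (i : ℤ)).eval (clenshawCurtisNode N k) = cos (i * k * π / N) := by
    intro k; rw [clenshawCurtisNode, T_real_cos]; push_cast; ring_nf
  simp_rw [hT]
  set β : ℕ → ℝ := fun j => (if 2 * j = N then (1 : ℝ) else 2) / (4 * (j : ℝ) ^ 2 - 1) with hβ
  have hsplit : ∀ k : ℕ, clenshawCurtisWeight N k * cos (i * k * π / N)
      = 1 / N * (clenshawCurtisMult N k * cos (i * k * π / N))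
        - 1 / N * ∑ j ∈ Icc 1 (N / 2), β j * (clenshawCurtisMult N k * (cos (2 * j * k * π / N) * cos (i * k * π / N))) := by
    intro k
    rw [clenshawCurtisWeight, mul_sum]
    simp only [hβ]
    have : ∑ j ∈ Icc 1 (N / 2), 1 / (N : ℝ) * ((if 2 * j = N then (1 : ℝ) else 2) / (4 * (j : ℝ) ^ 2 - 1)
          * (clenshawCurtisMult N k * (cos (2 * j * k * π / N) * cos (i * k * π / N))))
        = clenshawCurtisMult N k / N * (∑ j ∈ Icc 1 (N / 2), (if 2 * j = N then (1 : ℝ) else 2) / (4 * (j : ℝ) ^ 2 - 1)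
          * cos (2 * j * k * π / N)) * cos (i * k * π / N) := by
      rw [mul_sum, sum_mul]; exact sum_congr rfl fun j _ => by ring
    rw [this]; ring
  have hB : ∑ j ∈ Icc 1 (N / 2), β j
        * ∑ k ∈ range (N + 1), clenshawCurtisMult N k * (cos (2 * j * k * π / N) * cos (i * k * π / N))
      = ∑ j ∈ Icc 1 (N / 2), β j
        * ((N : ℝ) * ((if 2 * j + i = 2 * N then 1 else 0) + (if 2 * j = i then 1 else 0))) :=
    sum_congr rfl fun j hj => by rw [sum_clenshawCurtisMult_cos_cos hj hi]
  have hLHS : ∑ k ∈ range (N + 1), clenshawCurtisWeight N k * cos (i * k * π / N)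
      = 1 / N * ∑ k ∈ range (N + 1), clenshawCurtisMult N k * cos (i * k * π / N)
        - 1 / N * ∑ j ∈ Icc 1 (N / 2), β j
          * ((N : ℝ) * ((if 2 * j + i = 2 * N then 1 else 0) + (if 2 * j = i then 1 else 0))) := by
    rw [← hB, sum_congr rfl fun k _ => hsplit k, sum_sub_distrib, ← mul_sum, ← mul_sum, sum_comm]
    simp_rw [← mul_sum]
  rw [hLHS]
  have hcos := sum_clenshawCurtisMult_mul_cos hN (i : ℤ)
  push_cast at hcos
  rw [hcos]
  rcases Nat.eq_zero_or_pos i with hi0 | hi0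
  · -- `i = 0`
    subst hi0
    rw [if_pos (by simp)]
    have : ∑ j ∈ Icc 1 (N / 2), β j
        * ((N : ℝ) * ((if 2 * j + 0 = 2 * N then 1 else 0) + (if 2 * j = 0 then 1 else 0))) = 0 := by
      refine sum_eq_zero fun j hj => ?_
      obtain ⟨hj1, hj2⟩ := mem_Icc.mp hj
      rw [if_neg (by omega), if_neg (by omega)]; ring
    rw [this]
    field_simp
    ring
  · have hndvd : ¬ (2 * (N : ℤ) ∣ (i : ℤ)) := by
      intro hd; have := Int.le_of_dvd (by exact_mod_cast hi0) hd; omega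
    rw [if_neg hndvd, mul_zero, zero_sub]
    rcases Nat.even_or_odd i with ⟨m, hm⟩ | hodd
    · -- `i = 2m`, `1 ≤ m ≤ N/2`: only `j = m` contributes (twice if `i = N`)
      have hm' : i = 2 * m := by omega
      have hmI : m ∈ Icc 1 (N / 2) := mem_Icc.mpr ⟨by omega, by omega⟩
      rw [sum_eq_single_of_mem m hmI (fun j hj hjm => by
            obtain ⟨hj1, hj2⟩ := mem_Icc.mp hj
            rw [if_neg (by omega), if_neg (by omega)]; ring)]
      have hir : (i : ℝ) = 2 * m := by rw [hm']; push_cast; ring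
      have hev : ((-1 : ℝ)) ^ i = 1 := by rw [hm']; exact (even_two_mul m).neg_one_pow
      rw [hir, hev, if_pos hm'.symm]
      have hm1 : (1 : ℝ) ≤ m := by exact_mod_cast (show 1 ≤ m by omega)
      have hden : (4 : ℝ) * (m : ℝ) ^ 2 - 1 ≠ 0 := by nlinarith
      have hden' : (1 : ℝ) - (2 * (m : ℝ)) ^ 2 ≠ 0 := by nlinarith
      by_cases hiN : i = N
      · -- `i = N` even: both indicators fire and `β m = 1/(N² - 1)`
        have h2m : 2 * m = N := by omega
        simp only [hβ, if_pos h2m, if_pos (show 2 * m + i = 2 * N by omega)]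
        rw [eq_div_iff hden']
        field_simp
        ring
      · have h2m : 2 * m ≠ N := by omega
        simp only [hβ, if_neg h2m, if_neg (show 2 * m + i ≠ 2 * N by omega)]
        rw [eq_div_iff hden']
        field_simp
        ring
    · -- `i` odd
      have : ∑ j ∈ Icc 1 (N / 2), β j
          * ((N : ℝ) * ((if 2 * j + i = 2 * N then 1 else 0) + (if 2 * j = i then 1 else 0))) = 0 := by
        refine sum_eq_zero fun j _ => ?_
        rw [if_neg (by intro h; apply Nat.not_even_iff_odd.mpr hodd; exact ⟨N - j, by omega⟩),
          if_neg (by intro h; apply Nat.not_even_iff_odd.mpr hodd; exact ⟨j, by omega⟩)]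
        ring
      rw [this, mul_zero, neg_zero, hodd.neg_one_pow]
      ring

/-- **The `(N+1)`-point Clenshaw–Curtis rule is exact on `𝒫_N`** (an interpolatory rule on `N + 1`
points; the text's "`f ∈ 𝒫_{n-1}`", `n = N + 1`). [cite: DavisRabinowitz1984, Sect. 2.5.5 (2.5.5.8)] -/
theorem clenshawCurtis_exact {N : ℕ} (hN : N ≠ 0) {P : ℝ[X]} (hP : P.degree < (N + 1 : ℕ)) :
    clenshawCurtis N (fun x => P.eval x) = ∫ x in (-1 : ℝ)..1, P.eval x :=
  nodeSum_exact_of_chebyshevT (range (N + 1)) (clenshawCurtisWeight N) (clenshawCurtisNode N)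
    (fun i hi => by
      rw [integral_chebyshevT i]
      exact clenshawCurtis_chebyshevT hN (Nat.lt_succ_iff.mp hi)) hP

/-- The two end-point weights of the Clenshaw–Curtis rule coincide. [cite: DavisRabinowitz1984, Sect. 2.5.5 (2.5.5.8)] -/
theorem clenshawCurtisWeight_last {N : ℕ} (hN : N ≠ 0) : clenshawCurtisWeight N N = clenshawCurtisWeight N 0 := by
  have hNr : (N : ℝ) ≠ 0 := by exact_mod_cast hN
  unfold clenshawCurtisWeight clenshawCurtisMult
  simp only [or_true, true_or, if_true, Nat.cast_zero, mul_zero, zero_mul, zero_div, cos_zero]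
  congr 1; congr 1
  refine sum_congr rfl fun j _ => ?_
  rw [show (2 : ℝ) * j * N * π / N = (2 * j : ℕ) * π by push_cast; field_simp,
    cos_nat_mul_pi, pow_mul]
  norm_num

/-- End-point Clenshaw–Curtis weight, `N` odd (`n = N + 1` even): `w_1 = w_n = 1/N² = 1/(n-1)²`.
[cite: DavisRabinowitz1984, Sect. 2.5.5 (2.5.5.8)] -/
theorem clenshawCurtisWeight_zero_odd {N : ℕ} (hN : Odd N) : clenshawCurtisWeight N 0 = 1 / (N : ℝ) ^ 2 := by
  obtain ⟨M, rfl⟩ := hN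
  unfold clenshawCurtisWeight clenshawCurtisMult
  simp only [true_or, if_true, Nat.cast_zero, mul_zero, zero_mul, zero_div, cos_zero, mul_one]
  have hhalf : (2 * M + 1) / 2 = M := by omega
  rw [hhalf]
  have hb : ∀ j ∈ Icc 1 M, (if 2 * j = 2 * M + 1 then (1 : ℝ) else 2) / (4 * (j : ℝ) ^ 2 - 1)
      = 2 * (1 / (4 * (j : ℝ) ^ 2 - 1)) := by
    intro j _; rw [if_neg (by omega)]; ring
  rw [sum_congr rfl hb, ← mul_sum, sum_inv_four_sq_sub_one]
  have h1 : (2 : ℝ) * M + 1 ≠ 0 := by positivity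
  push_cast
  field_simp
  ring

/-- End-point Clenshaw–Curtis weight, `N ≥ 2` even (`n = N + 1` odd): `w_1 = w_n = 1/(N² - 1) = 1/(n(n-2))`
(here the halved last term of `Σ*` enters). [cite: DavisRabinowitz1984, Sect. 2.5.5 (2.5.5.8)] -/
theorem clenshawCurtisWeight_zero_even {N : ℕ} (hN : Even N) (hN0 : N ≠ 0) :
    clenshawCurtisWeight N 0 = 1 / ((N : ℝ) ^ 2 - 1) := by
  obtain ⟨M', hM'⟩ := hN
  obtain ⟨M, rfl⟩ : ∃ M, M' = M + 1 := ⟨M' - 1, by omega⟩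
  have hNM : N = 2 * M + 2 := by omega
  subst hNM
  unfold clenshawCurtisWeight clenshawCurtisMult
  simp only [true_or, if_true, Nat.cast_zero, mul_zero, zero_mul, zero_div, cos_zero, mul_one]
  have hhalf : (2 * M + 2) / 2 = M + 1 := by omega
  rw [hhalf, sum_Icc_succ_top (by omega), if_pos (by ring)]
  have hb : ∀ j ∈ Icc 1 M, (if 2 * j = 2 * M + 2 then (1 : ℝ) else 2) / (4 * (j : ℝ) ^ 2 - 1)
      = 2 * (1 / (4 * (j : ℝ) ^ 2 - 1)) := by
    intro j hj; rw [if_neg (by have := (mem_Icc.mp hj).2; omega)]; ring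
  rw [sum_congr rfl hb, ← mul_sum, sum_inv_four_sq_sub_one]
  have hM : (0 : ℝ) ≤ M := by positivity
  have h1 : (2 : ℝ) * M + 1 ≠ 0 := by positivity
  have h2 : (4 : ℝ) * ((M + 1 : ℕ) : ℝ) ^ 2 - 1 ≠ 0 := by push_cast; nlinarith
  have h3 : (((2 * M + 2 : ℕ) : ℝ)) ^ 2 - 1 ≠ 0 := by push_cast; nlinarith
  have h4 : ((2 * M + 2 : ℕ) : ℝ) ≠ 0 := by positivity
  field_simp
  push_cast
  ring

/-- The Clenshaw–Curtis weights sum to `2`. [cite: DavisRabinowitz1984, Sect. 2.5.5 (2.5.5.8)] -/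
theorem sum_clenshawCurtisWeight {N : ℕ} (hN : N ≠ 0) : ∑ k ∈ range (N + 1), clenshawCurtisWeight N k = 2 := by
  have h := clenshawCurtis_chebyshevT (i := 0) hN (Nat.zero_le N)
  unfold clenshawCurtis at h
  have h' : ∑ k ∈ range (N + 1), clenshawCurtisWeight N k
      = ∑ k ∈ range (N + 1), clenshawCurtisWeight N k * (fun x => (T ℝ ((0 : ℕ) : ℤ)).eval x) (clenshawCurtisNode N k) := by
    refine sum_congr rfl fun k _ => ?_
    simp
  rw [h', h]
  norm_num

/-! ## Fejér's second rule (2.5.5.6)–(2.5.5.8) on the "Filippi" abscissas `cos(kπ/(n+1))` -/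

/-- The angles of Fejér's second rule, `θ_k = kπ/(n+1)`, `k = 1, …, n`; with a `0`-based index,
`fejerTwoAngle n k = (k+1)π/(n+1)`, `k < n`. [cite: DavisRabinowitz1984, Sect. 2.5.5 (2.5.5.6)] -/
def fejerTwoAngle (n k : ℕ) : ℝ := ((k + 1 : ℕ) : ℝ) * π / ((n + 1 : ℕ) : ℝ)

/-- The "Filippi" abscissas `cos(kπ/(n+1))`, `k = 1, …, n` — the zeros of `U_n`.
[cite: DavisRabinowitz1984, Sect. 2.5.5 (2.5.5.6)] -/
def fejerTwoNode (n k : ℕ) : ℝ := cos (fejerTwoAngle n k)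

/-- The weights of Fejér's second rule in the closed form (2.5.5.8):
`w_k = (4 sin θ_k/(n+1)) Σ_{m=1}^{⌊(n+1)/2⌋} sin((2m-1)θ_k)/(2m-1)`.
[cite: DavisRabinowitz1984, Sect. 2.5.5 (2.5.5.8)] -/
def fejerTwoWeight (n k : ℕ) : ℝ :=
  4 * sin (fejerTwoAngle n k) / ((n + 1 : ℕ) : ℝ)
    * ∑ m ∈ Icc 1 ((n + 1) / 2), sin ((2 * (m : ℝ) - 1) * fejerTwoAngle n k) / (2 * (m : ℝ) - 1)

/-- Fejér's second rule `Σ_{k=1}^{n} w_k f(cos(kπ/(n+1)))` (2.5.5.6).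
[cite: DavisRabinowitz1984, Sect. 2.5.5 (2.5.5.6)] -/
def fejerTwo (n : ℕ) (f : ℝ → ℝ) : ℝ := ∑ k ∈ range n, fejerTwoWeight n k * f (fejerTwoNode n k)

/-- The node sums of Fejér's second rule:
`Σ_{k=1}^{n} cos(akπ/(n+1)) = (n+1)·[2(n+1) ∣ a] - (1 + cos aπ)/2`. [folklore] -/
private theorem sum_cos_fejerTwoAngle (n : ℕ) (a : ℤ) :
    ∑ k ∈ range n, cos (a * fejerTwoAngle n k)
      = (if (2 * ((n + 1 : ℕ) : ℤ)) ∣ a then ((n + 1 : ℕ) : ℝ) else 0) - (1 + cos (a * π)) / 2 := by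
  have hn1 : ((n + 1 : ℕ) : ℝ) ≠ 0 := by positivity
  have h := sum_cos_mul_pi_div_add (N := n + 1) (by omega) a
  have h1 : ∑ k ∈ range (n + 1), cos (a * k * π / ((n + 1 : ℕ) : ℝ))
      = (∑ k ∈ range n, cos (a * fejerTwoAngle n k)) + 1 := by
    rw [sum_range_succ']
    simp only [Nat.cast_zero, mul_zero, zero_mul, zero_div, cos_zero]
    congr 1
    refine sum_congr rfl fun k _ => ?_
    unfold fejerTwoAngle; congr 1; ring
  have h2 : ∑ k ∈ range (n + 1), cos (a * ((k + 1 : ℕ) : ℝ) * π / ((n + 1 : ℕ) : ℝ))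
      = (∑ k ∈ range n, cos (a * fejerTwoAngle n k)) + cos (a * π) := by
    rw [sum_range_succ]
    congr 1
    · refine sum_congr rfl fun k _ => ?_
      unfold fejerTwoAngle; congr 1; ring
    · congr 1; field_simp
  rw [h1, h2] at h
  by_cases hd : (2 * ((n + 1 : ℕ) : ℤ)) ∣ a
  · rw [if_pos hd] at h ⊢; linarith
  · rw [if_neg hd] at h ⊢; linarith

/-- `sin θ · sin(cθ) · cos(jθ) = (cos((c-1-j)θ) + cos((c-1+j)θ) - cos((c+1-j)θ) - cos((c+1+j)θ))/4`. [folklore] -/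
private theorem sin_mul_sin_mul_cos (c j θ : ℝ) :
    sin θ * sin (c * θ) * cos (j * θ)
      = (cos ((c - 1 - j) * θ) + cos ((c - 1 + j) * θ)
          - cos ((c + 1 - j) * θ) - cos ((c + 1 + j) * θ)) / 4 := by
  have h1 : sin θ * sin (c * θ) = (cos ((c - 1) * θ) - cos ((c + 1) * θ)) / 2 := by
    rw [sub_mul, add_mul, one_mul, cos_sub, cos_add]; ring
  rw [h1, div_mul_eq_mul_div, sub_mul, cos_mul_cos_eq, cos_mul_cos_eq]
  ring_nf

/-- For `|a| < d`: `d ∣ a ↔ a = 0`. [folklore] -/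
private theorem dvd_iff_eq_zero_of_lt {d a : ℤ} (h1 : -d < a) (h2 : a < d) : d ∣ a ↔ a = 0 := by
  constructor
  · intro hd
    by_contra h0
    have := Int.natAbs_le_of_dvd_ne_zero hd h0
    omega
  · rintro rfl; exact dvd_zero _

/-- **Fejér's second rule on the Chebyshev polynomials** `T_j`, `j < n`:
`Σ_k w_k T_j(cos θ_k) = (1 + (-1)^j)/(1 - j²) = ∫_{-1}^{1} T_j`, with the weights (2.5.5.8).
[cite: DavisRabinowitz1984, Sect. 2.5.5 (2.5.5.6)–(2.5.5.8)] -/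
theorem fejerTwo_chebyshevT {n j : ℕ} (hj : j < n) :
    fejerTwo n (fun x => (T ℝ j).eval x) = (1 + (-1) ^ j) / (1 - (j : ℝ) ^ 2) := by
  have hN1 : ((n + 1 : ℕ) : ℝ) ≠ 0 := by positivity
  unfold fejerTwo
  have hT : ∀ k : ℕ, (T ℝ (j : ℤ)).eval (fejerTwoNode n k) = cos (j * fejerTwoAngle n k) := by
    intro k; rw [fejerTwoNode, T_real_cos]; push_cast; ring_nf
  simp_rw [hT]
  set M := (n + 1) / 2 with hM
  -- the four frequencies
  have hprod : ∀ m k : ℕ, sin (fejerTwoAngle n k) * sin ((2 * (m : ℝ) - 1) * fejerTwoAngle n k)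
        * cos (j * fejerTwoAngle n k)
      = (cos (((((2 * m : ℕ) : ℤ) - 2 - j : ℤ)) * fejerTwoAngle n k)
          + cos (((((2 * m : ℕ) : ℤ) - 2 + j : ℤ)) * fejerTwoAngle n k)
          - cos (((((2 * m : ℕ) : ℤ) - j : ℤ)) * fejerTwoAngle n k)
          - cos ((((2 * m + j : ℕ) : ℤ)) * fejerTwoAngle n k)) / 4 := by
    intro m k
    rw [sin_mul_sin_mul_cos]
    push_cast
    ring_nf
  have hsplit : ∀ k : ℕ, fejerTwoWeight n k * cos (j * fejerTwoAngle n k)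
      = 1 / ((n + 1 : ℕ) : ℝ) * ∑ m ∈ Icc 1 M, 1 / (2 * (m : ℝ) - 1)
        * (cos (((((2 * m : ℕ) : ℤ) - 2 - j : ℤ)) * fejerTwoAngle n k)
          + cos (((((2 * m : ℕ) : ℤ) - 2 + j : ℤ)) * fejerTwoAngle n k)
          - cos (((((2 * m : ℕ) : ℤ) - j : ℤ)) * fejerTwoAngle n k)
          - cos ((((2 * m + j : ℕ) : ℤ)) * fejerTwoAngle n k)) := by
    intro k
    rw [fejerTwoWeight, mul_sum, sum_mul, mul_sum]
    refine sum_congr rfl fun m _ => ?_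
    calc _ = 4 / ((n + 1 : ℕ) : ℝ) * (1 / (2 * (m : ℝ) - 1)) * (sin (fejerTwoAngle n k)
          * sin ((2 * (m : ℝ) - 1) * fejerTwoAngle n k) * cos (j * fejerTwoAngle n k)) := by ring
      _ = _ := by rw [hprod m k]; ring
  rw [sum_congr rfl fun k _ => hsplit k, ← mul_sum, sum_comm]
  simp_rw [← mul_sum, sum_sub_distrib, sum_add_distrib, sum_cos_fejerTwoAngle n]
  -- the parity corrections `(1 + cos aπ)/2` are all equal to `(1 + cos jπ)/2` and cancel
  have hc1 : ∀ m : ℕ, cos (((((2 * m : ℕ) : ℤ) - 2 - j : ℤ) : ℝ) * π) = cos (j * π) := by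
    intro m
    rw [show (((((2 * m : ℕ) : ℤ) - 2 - j : ℤ) : ℝ) * π) = ((m : ℤ) - 1 : ℤ) * (2 * π) - j * π by
      push_cast; ring, cos_int_mul_two_pi_sub]
  have hc2 : ∀ m : ℕ, cos (((((2 * m : ℕ) : ℤ) - 2 + j : ℤ) : ℝ) * π) = cos (j * π) := by
    intro m
    rw [show (((((2 * m : ℕ) : ℤ) - 2 + j : ℤ) : ℝ) * π) = j * π + ((m : ℤ) - 1 : ℤ) * (2 * π) by
      push_cast; ring, cos_add_int_mul_two_pi]
  have hc3 : ∀ m : ℕ, cos (((((2 * m : ℕ) : ℤ) - j : ℤ) : ℝ) * π) = cos (j * π) := by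
    intro m
    rw [show (((((2 * m : ℕ) : ℤ) - j : ℤ) : ℝ) * π) = ((m : ℤ)) * (2 * π) - j * π by
      push_cast; ring, cos_int_mul_two_pi_sub]
  have hc4 : ∀ m : ℕ, cos ((((2 * m + j : ℕ) : ℤ) : ℝ) * π) = cos (j * π) := by
    intro m
    rw [show ((((2 * m + j : ℕ) : ℤ) : ℝ) * π) = j * π + ((m : ℤ)) * (2 * π) by
      push_cast; ring, cos_add_int_mul_two_pi]
  simp_rw [hc1, hc2, hc3, hc4]
  -- the divisibilities are equalities (all four frequencies lie in `(-2(n+1), 2(n+1))`)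
  have hterm : ∀ m ∈ Icc 1 M, 1 / (2 * (m : ℝ) - 1) *
      ((if (2 * ((n + 1 : ℕ) : ℤ)) ∣ ((((2 * m : ℕ) : ℤ) - 2 - j : ℤ)) then ((n + 1 : ℕ) : ℝ) else 0)
          - (1 + cos (j * π)) / 2
        + ((if (2 * ((n + 1 : ℕ) : ℤ)) ∣ ((((2 * m : ℕ) : ℤ) - 2 + j : ℤ)) then ((n + 1 : ℕ) : ℝ) else 0)
          - (1 + cos (j * π)) / 2)
        - ((if (2 * ((n + 1 : ℕ) : ℤ)) ∣ ((((2 * m : ℕ) : ℤ) - j : ℤ)) then ((n + 1 : ℕ) : ℝ) else 0)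
          - (1 + cos (j * π)) / 2)
        - ((if (2 * ((n + 1 : ℕ) : ℤ)) ∣ (((2 * m + j : ℕ) : ℤ)) then ((n + 1 : ℕ) : ℝ) else 0)
          - (1 + cos (j * π)) / 2))
      = ((n + 1 : ℕ) : ℝ) * ((if 2 * m = j + 2 then 1 / (2 * (m : ℝ) - 1) else 0)
          + (if 2 * m + j = 2 then 1 / (2 * (m : ℝ) - 1) else 0)
          - (if 2 * m = j then 1 / (2 * (m : ℝ) - 1) else 0)) := by
    intro m hm
    obtain ⟨hm1, hm2⟩ := mem_Icc.mp hm
    have hmn : 2 * m ≤ n + 1 := by omega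
    have e1 : (2 * ((n + 1 : ℕ) : ℤ)) ∣ ((((2 * m : ℕ) : ℤ) - 2 - j : ℤ)) ↔ 2 * m = j + 2 := by
      rw [dvd_iff_eq_zero_of_lt (by push_cast; omega) (by push_cast; omega)]; omega
    have e2 : (2 * ((n + 1 : ℕ) : ℤ)) ∣ ((((2 * m : ℕ) : ℤ) - 2 + j : ℤ)) ↔ 2 * m + j = 2 := by
      rw [dvd_iff_eq_zero_of_lt (by push_cast; omega) (by push_cast; omega)]; omega
    have e3 : (2 * ((n + 1 : ℕ) : ℤ)) ∣ ((((2 * m : ℕ) : ℤ) - j : ℤ)) ↔ 2 * m = j := by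
      rw [dvd_iff_eq_zero_of_lt (by push_cast; omega) (by push_cast; omega)]; omega
    have e4 : ¬ (2 * ((n + 1 : ℕ) : ℤ)) ∣ (((2 * m + j : ℕ) : ℤ)) := by
      rw [dvd_iff_eq_zero_of_lt (by push_cast; omega) (by push_cast; omega)]; omega
    simp only [e1, e2, e3, if_neg e4]
    split_ifs <;> ring
  rw [sum_congr rfl hterm, ← mul_sum, sum_sub_distrib, sum_add_distrib]
  -- evaluate the three indicator sums
  rcases Nat.even_or_odd j with ⟨i, hi⟩ | hodd
  · have hji : j = 2 * i := by omega
    have hev : ((-1 : ℝ)) ^ j = 1 := by rw [hji]; exact (even_two_mul i).neg_one_pow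
    have hjr : (j : ℝ) = 2 * i := by rw [hji]; push_cast; ring
    have hmemI1 : i + 1 ∈ Icc 1 M := mem_Icc.mpr ⟨by omega, by omega⟩
    have hS1 : ∑ m ∈ Icc 1 M, (if 2 * m = j + 2 then 1 / (2 * (m : ℝ) - 1) else 0)
        = 1 / (2 * ((i + 1 : ℕ) : ℝ) - 1) := by
      rw [sum_eq_single_of_mem (i + 1) hmemI1 (fun m _ hne => if_neg (by omega)), if_pos (by omega)]
    rcases Nat.eq_zero_or_pos i with hi0 | hipos
    · -- `j = 0`
      subst hi0
      have hM1 : 1 ∈ Icc 1 M := mem_Icc.mpr ⟨le_rfl, by omega⟩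
      have hS2 : ∑ m ∈ Icc 1 M, (if 2 * m + j = 2 then 1 / (2 * (m : ℝ) - 1) else 0) = 1 := by
        rw [sum_eq_single_of_mem 1 hM1 (fun m _ hne => if_neg (by omega)), if_pos (by omega)]
        norm_num
      have hS3 : ∑ m ∈ Icc 1 M, (if 2 * m = j then 1 / (2 * (m : ℝ) - 1) else 0) = 0 :=
        sum_eq_zero fun m hm => if_neg (by have := (mem_Icc.mp hm).1; omega)
      rw [hS1, hS2, hS3, hev, hjr]
      push_cast
      field_simp
      norm_num
    · -- `j = 2i`, `i ≥ 1`
      have hmemI : i ∈ Icc 1 M := mem_Icc.mpr ⟨hipos, by omega⟩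
      have hS2 : ∑ m ∈ Icc 1 M, (if 2 * m + j = 2 then 1 / (2 * (m : ℝ) - 1) else 0) = 0 :=
        sum_eq_zero fun m hm => if_neg (by have := (mem_Icc.mp hm).1; omega)
      have hS3 : ∑ m ∈ Icc 1 M, (if 2 * m = j then 1 / (2 * (m : ℝ) - 1) else 0)
          = 1 / (2 * (i : ℝ) - 1) := by
        rw [sum_eq_single_of_mem i hmemI (fun m _ hne => if_neg (by omega)), if_pos (by omega)]
      have hi1 : (1 : ℝ) ≤ i := by exact_mod_cast hipos
      have hd1 : (2 : ℝ) * i - 1 ≠ 0 := by linarith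
      have hd2 : (2 : ℝ) * ((i : ℝ) + 1) - 1 ≠ 0 := by linarith
      have hd3 : (1 : ℝ) - (2 * (i : ℝ)) ^ 2 ≠ 0 := by nlinarith
      rw [hS1, hS2, hS3, hev, hjr]
      push_cast
      rw [eq_div_iff hd3, add_zero, div_sub_div _ _ hd2 hd1]
      field_simp
      ring
  · -- `j` odd: every indicator vanishes
    have h0 : ∀ m ∈ Icc 1 M, ((if 2 * m = j + 2 then 1 / (2 * (m : ℝ) - 1) else 0)
          + (if 2 * m + j = 2 then 1 / (2 * (m : ℝ) - 1) else 0)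
          - (if 2 * m = j then 1 / (2 * (m : ℝ) - 1) else 0)) = 0 := by
      intro m _
      rw [if_neg (by intro h; apply Nat.not_even_iff_odd.mpr hodd; exact ⟨m - 1, by omega⟩),
        if_neg (by intro h; apply Nat.not_even_iff_odd.mpr hodd; exact ⟨1 - m, by omega⟩),
        if_neg (by intro h; apply Nat.not_even_iff_odd.mpr hodd; exact ⟨m, by omega⟩)]
      ring
    rw [← sum_add_distrib, ← sum_sub_distrib, sum_congr rfl h0, sum_const_zero, mul_zero, mul_zero,
      hodd.neg_one_pow]
    ring

/-- **Fejér's second rule (2.5.5.6) is exact on `𝒫_{n-1}`.** [cite: DavisRabinowitz1984, Sect. 2.5.5 (2.5.5.6)] -/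
theorem fejerTwo_exact {n : ℕ} {P : ℝ[X]} (hP : P.degree < n) :
    fejerTwo n (fun x => P.eval x) = ∫ x in (-1 : ℝ)..1, P.eval x :=
  nodeSum_exact_of_chebyshevT (range n) (fejerTwoWeight n) (fejerTwoNode n)
    (fun i hi => by rw [integral_chebyshevT i]; exact fejerTwo_chebyshevT hi) hP

/-- The weights of Fejér's second rule sum to `2`. [cite: DavisRabinowitz1984, Sect. 2.5.5 (2.5.5.6)] -/
theorem sum_fejerTwoWeight {n : ℕ} (hn : n ≠ 0) : ∑ k ∈ range n, fejerTwoWeight n k = 2 := by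
  have h := fejerTwo_chebyshevT (n := n) (j := 0) (Nat.pos_of_ne_zero hn)
  unfold fejerTwo at h
  have h' : ∑ k ∈ range n, fejerTwoWeight n k
      = ∑ k ∈ range n, fejerTwoWeight n k * (fun x => (T ℝ ((0 : ℕ) : ℤ)).eval x) (fejerTwoNode n k) := by
    refine sum_congr rfl fun k _ => ?_
    simp
  rw [h', h]
  norm_num

end

end Literature.Analysis.Quadrature
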